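import Summits.CriticalPhenomena.SAWScalingLimit.Theorems.SAWDevelopingMapNoFoldBoundBoundaryLayerCore
import Summits.CriticalPhenomena.SAWScalingLimit.Theorems.SAWDevelopingMapNoFoldBoundLoopWinding
import Summits.CriticalPhenomena.SAWScalingLimit.Theorems.SAWDevelopingMapNoFoldBoundLocalTurns
import Summits.CriticalPhenomena.SAWScalingLimit.Theorems.SAWDefectDecoherenceBoundaryClosureRIdentificationReciprocity
import Summits.CriticalPhenomena.SAWScalingLimit.Theorems.SAWDevelopingMapNoFoldBoundAlgebraA

/-!
# `NoFoldBound` implies `SourceLoopBound` (the crux is at least as hard as the source-loop item)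

Crux `NoFoldBound` (stmt-CriticalPhenomena-8296) and support item `SourceLoopBound`
(stmt-CriticalPhenomena-8300) of the route `SAWDevelopingMap`. At the SOURCE vertex `v` of a
simply connected domain (`a = {u, v}`, `u ∉ Λ`) the exact source law (`SourceLoopBound.sourcePort`)
with the loop winding (`stub_loopWinding`) and the local turns (`stub_localTurns`) evaluates the
triple of the critical observable as `(1, x_c e^{∓5iπ/24} + x_c Z e^{∓5iπ/6}, c.c.)` with
`Z = Σ_{loops of Λ∖v around v} x_c^ℓ` (the two orientations of the loops have the same real
generating function: reciprocity `hexParafermionicObservable_zero_symm`). Its sum mode is the REAL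
number `α_T − √3 x_c Z` and its Beltrami mode (non-DCS labelling) the real number `β_T + √3 x_c Z`,
so the no-fold inequality with constant `k < 1` at the source vertex is EQUIVALENT to
`Z ≤ (kα_T − β_T)/((1+k)√3 x_c) < sin(π/8)` (`α_T − β_T = 2√3 x_c sin(π/8)`). Hence

* `sourceLoopBound_of_noFoldBound : NoFoldBound → SourceLoopBound`.

Consequence for the route: `NoFoldBound` cannot close before `SourceLoopBound`, whose prover seat
graded it an open problem (a sharp inequality on a critical rooted self-avoiding-polygon series).
-/

noncomputable section

open scoped BigOperators
open Literature.Probability.LatticeModels Literature.Probability.RandomPlanarGeometry.SAW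

namespace Summit.CriticalPhenomena.SAWScalingLimit.Theorems.SAWDevelopingMapNoFoldBound

/-! ## Reciprocity of the loop sums -/

/-- No walk of `Λ'` ends on a mid-edge both of whose endpoints lie outside `Λ'`, unless it is the
trivial walk. [folklore] -/
theorem isEmpty_saw_of_notMem {Λ' : Finset HexVertex} {a : Sym2 HexVertex} {v p : HexVertex}
    (hv : v ∉ Λ') (hp : p ∉ Λ') (ha : a ≠ s(v, p)) : IsEmpty (HexMidEdgeSAW Λ' a s(v, p)) := by
  refine ⟨fun γ => ?_⟩
  by_cases hne : γ.verts = []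
  · exact ha (γ.eq_of_nil hne)
  · have hlast := γ.getLast_mem (γ.verts.getLast hne) (List.getLast?_eq_getLast_of_ne_nil hne)
    have hmem : γ.verts.getLast hne ∈ Λ' := γ.subset _ (List.getLast_mem hne)
    rcases Sym2.mem_iff.1 hlast with h | h
    · exact hv (h ▸ hmem)
    · exact hp (h ▸ hmem)

/-- No walk of `Λ'` starts on a mid-edge both of whose endpoints lie outside `Λ'`. [folklore] -/
theorem isEmpty_saw_of_notMem_fst {Λ' : Finset HexVertex} {z : Sym2 HexVertex} {v p : HexVertex}
    (hv : v ∉ Λ') (hp : p ∉ Λ') : IsEmpty (HexMidEdgeSAW Λ' s(v, p) z) := by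
  refine ⟨fun γ => ?_⟩
  obtain ⟨-, w, hw, hwΛ⟩ := γ.fst_mem
  rcases Sym2.mem_iff.1 hw with rfl | rfl
  · exact hv hwΛ
  · exact hp hwΛ

/-- **Reciprocity of the returning-loop sums**: the real generating functions of the loops of
`Λ ∖ {v}` from `{v, q}` to `{v, p}` and from `{v, p}` to `{v, q}` agree (reverse the walk;
`hexParafermionicObservable_zero_symm`), for neighbours `p ≠ q` of `v`. [folklore] -/
theorem loopSum_symm {Λ : Finset HexVertex} {v p q : HexVertex} (hp : hexGraph.Adj v p)
    (hq : hexGraph.Adj v q) (hpq : p ≠ q) (x : ℝ) :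
    (∑ δ : HexMidEdgeSAW (Λ.erase v) s(v, q) s(v, p), x ^ δ.length) =
      ∑ δ : HexMidEdgeSAW (Λ.erase v) s(v, p) s(v, q), x ^ δ.length := by
  have hv : v ∉ Λ.erase v := fun h => (Finset.mem_erase.1 h).1 rfl
  have hne : s(v, q) ≠ s(v, p) := by
    rw [Ne, Sym2.eq_iff]
    rintro (⟨-, h⟩ | ⟨h, -⟩)
    · exact hpq h.symm
    · exact hp.ne h
  by_cases hpΛ : p ∈ Λ
  · by_cases hqΛ : q ∈ Λ
    · have hpm : s(v, p) ∈ hexDomainMidEdges (Λ.erase v) :=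
        ⟨(SimpleGraph.mem_edgeSet hexGraph).2 hp, p, Sym2.mem_mk_right _ _,
          Finset.mem_erase.2 ⟨hp.ne.symm, hpΛ⟩⟩
      have hqm : s(v, q) ∈ hexDomainMidEdges (Λ.erase v) :=
        ⟨(SimpleGraph.mem_edgeSet hexGraph).2 hq, q, Sym2.mem_mk_right _ _,
          Finset.mem_erase.2 ⟨hq.ne.symm, hqΛ⟩⟩
      have h := PickHalfPlane.Identification.hexParafermionicObservable_zero_symm (Λ.erase v)
        s(v, q) s(v, p) hqm hpm x
      rw [hexParafermionicObservable_zero_spin, hexParafermionicObservable_zero_spin] at h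
      exact_mod_cast h
    · have hq' : q ∉ Λ.erase v := fun h => hqΛ (Finset.mem_of_mem_erase h)
      haveI := isEmpty_saw_of_notMem_fst (z := s(v, p)) hv hq'
      haveI := isEmpty_saw_of_notMem (a := s(v, p)) hv hq' hne.symm
      simp
  · have hp' : p ∉ Λ.erase v := fun h => hpΛ (Finset.mem_of_mem_erase h)
    haveI := isEmpty_saw_of_notMem (a := s(v, q)) hv hp' hne
    haveI := isEmpty_saw_of_notMem_fst (z := s(v, q)) hv hp'
    simp

/-! ## The source triple is real in the two modes -/

/-- The sum mode of the source triple is the real number `α_T − √3 x_c Z`: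
`1 + (x e(π/3) + x e(4π/3) Z) + (x e(−π/3) + x e(−4π/3) Z) = α_T − √3 x Z` for
`e(t) = e^{−5it/8}`. [folklore] -/
theorem source_sum_mode (Z : ℝ) :
    (1 : ℂ) + (hexCriticalFugacity * Complex.exp (-Complex.I * (5 / 8 : ℝ) * ((Real.pi / 3 : ℝ) : ℂ)) +
        hexCriticalFugacity * Complex.exp (-Complex.I * (5 / 8 : ℝ) * ((4 * (Real.pi / 3) : ℝ) : ℂ)) * Z) +
      (hexCriticalFugacity * Complex.exp (-Complex.I * (5 / 8 : ℝ) * ((-(Real.pi / 3) : ℝ) : ℂ)) +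
        hexCriticalFugacity * Complex.exp (-Complex.I * (5 / 8 : ℝ) * ((4 * -(Real.pi / 3) : ℝ) : ℂ)) * Z) =
      ((1 + 2 * hexCriticalFugacity * Real.cos (5 * Real.pi / 24) -
        Real.sqrt 3 * hexCriticalFugacity * Z : ℝ) : ℂ) := by
  have h1 := Complex.two_cos ((5 * Real.pi / 24 : ℝ) : ℂ)
  have h2 := Complex.two_cos ((5 * Real.pi / 6 : ℝ) : ℂ)
  have c2 : Real.cos (5 * Real.pi / 6) = -(Real.sqrt 3 / 2) := by
    rw [show (5 * Real.pi / 6 : ℝ) = Real.pi - Real.pi / 6 by ring, Real.cos_pi_sub,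
      Real.cos_pi_div_six]
  rw [← Complex.ofReal_cos, c2] at h2
  rw [← Complex.ofReal_cos] at h1
  have e1 : Complex.exp (-Complex.I * (5 / 8 : ℝ) * ((Real.pi / 3 : ℝ) : ℂ)) =
      Complex.exp (-((5 * Real.pi / 24 : ℝ) : ℂ) * Complex.I) := by
    congr 1; push_cast; ring
  have e2 : Complex.exp (-Complex.I * (5 / 8 : ℝ) * ((-(Real.pi / 3) : ℝ) : ℂ)) =
      Complex.exp (((5 * Real.pi / 24 : ℝ) : ℂ) * Complex.I) := by
    congr 1; push_cast; ring
  have e3 : Complex.exp (-Complex.I * (5 / 8 : ℝ) * ((4 * (Real.pi / 3) : ℝ) : ℂ)) =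
      Complex.exp (-((5 * Real.pi / 6 : ℝ) : ℂ) * Complex.I) := by
    congr 1; push_cast; ring
  have e4 : Complex.exp (-Complex.I * (5 / 8 : ℝ) * ((4 * -(Real.pi / 3) : ℝ) : ℂ)) =
      Complex.exp (((5 * Real.pi / 6 : ℝ) : ℂ) * Complex.I) := by
    congr 1; push_cast; ring
  rw [e1, e2, e3, e4]
  push_cast at h1 h2 ⊢
  linear_combination (-(hexCriticalFugacity : ℂ)) * h1 + (-((hexCriticalFugacity : ℂ) * Z)) * h2

/-- The Beltrami mode of the source triple in the labelling `(u, w₊, w₋)` (`w₊` the neighbour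
reached by the `+π/3` turn) is the real number `β_T + √3 x_c Z`:
`1 + ω(x e(π/3) + x e(4π/3) Z) + ω²(x e(−π/3) + x e(−4π/3) Z) = β_T + √3 x Z`. [folklore] -/
theorem source_belt_mode (Z : ℝ) :
    (1 : ℂ) + Complex.exp (2 * Real.pi * Complex.I / 3) *
        (hexCriticalFugacity * Complex.exp (-Complex.I * (5 / 8 : ℝ) * ((Real.pi / 3 : ℝ) : ℂ)) +
          hexCriticalFugacity * Complex.exp (-Complex.I * (5 / 8 : ℝ) * ((4 * (Real.pi / 3) : ℝ) : ℂ)) * Z) +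
      Complex.exp (2 * Real.pi * Complex.I / 3) ^ 2 *
        (hexCriticalFugacity * Complex.exp (-Complex.I * (5 / 8 : ℝ) * ((-(Real.pi / 3) : ℝ) : ℂ)) +
          hexCriticalFugacity * Complex.exp (-Complex.I * (5 / 8 : ℝ) * ((4 * -(Real.pi / 3) : ℝ) : ℂ)) * Z) =
      ((1 + 2 * hexCriticalFugacity * Real.cos (11 * Real.pi / 24) +
        Real.sqrt 3 * hexCriticalFugacity * Z : ℝ) : ℂ) := by
  have h1 := Complex.two_cos ((11 * Real.pi / 24 : ℝ) : ℂ)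
  have h2 := Complex.two_cos ((Real.pi / 6 : ℝ) : ℂ)
  rw [← Complex.ofReal_cos, Real.cos_pi_div_six] at h2
  rw [← Complex.ofReal_cos] at h1
  -- the four products of `ω`, `ω²` with the phases
  have e1 : Complex.exp (2 * Real.pi * Complex.I / 3) *
      Complex.exp (-Complex.I * (5 / 8 : ℝ) * ((Real.pi / 3 : ℝ) : ℂ)) =
      Complex.exp (((11 * Real.pi / 24 : ℝ) : ℂ) * Complex.I) := by
    rw [← Complex.exp_add]; congr 1; push_cast; ring
  have e2 : Complex.exp (2 * Real.pi * Complex.I / 3) ^ 2 *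
      Complex.exp (-Complex.I * (5 / 8 : ℝ) * ((-(Real.pi / 3) : ℝ) : ℂ)) =
      Complex.exp (-((11 * Real.pi / 24 : ℝ) : ℂ) * Complex.I) := by
    rw [sq, ← Complex.exp_add, ← Complex.exp_add,
      show (2 * Real.pi * Complex.I / 3 + 2 * Real.pi * Complex.I / 3 +
          -Complex.I * ((5 / 8 : ℝ) : ℂ) * ((-(Real.pi / 3) : ℝ) : ℂ) : ℂ) =
        -((11 * Real.pi / 24 : ℝ) : ℂ) * Complex.I + 2 * Real.pi * Complex.I by push_cast; ring,
      Complex.exp_add, Complex.exp_two_pi_mul_I, mul_one]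
  have e3 : Complex.exp (2 * Real.pi * Complex.I / 3) *
      Complex.exp (-Complex.I * (5 / 8 : ℝ) * ((4 * (Real.pi / 3) : ℝ) : ℂ)) =
      Complex.exp (-((Real.pi / 6 : ℝ) : ℂ) * Complex.I) := by
    rw [← Complex.exp_add]; congr 1; push_cast; ring
  have e4 : Complex.exp (2 * Real.pi * Complex.I / 3) ^ 2 *
      Complex.exp (-Complex.I * (5 / 8 : ℝ) * ((4 * -(Real.pi / 3) : ℝ) : ℂ)) =
      Complex.exp (((Real.pi / 6 : ℝ) : ℂ) * Complex.I) := by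
    rw [sq, ← Complex.exp_add, ← Complex.exp_add,
      show (2 * Real.pi * Complex.I / 3 + 2 * Real.pi * Complex.I / 3 +
          -Complex.I * ((5 / 8 : ℝ) : ℂ) * ((4 * -(Real.pi / 3) : ℝ) : ℂ) : ℂ) =
        ((Real.pi / 6 : ℝ) : ℂ) * Complex.I + 2 * Real.pi * Complex.I by push_cast; ring,
      Complex.exp_add, Complex.exp_two_pi_mul_I, mul_one]
  have expand : (1 : ℂ) + Complex.exp (2 * Real.pi * Complex.I / 3) *
        (hexCriticalFugacity * Complex.exp (-Complex.I * (5 / 8 : ℝ) * ((Real.pi / 3 : ℝ) : ℂ)) +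
          hexCriticalFugacity * Complex.exp (-Complex.I * (5 / 8 : ℝ) * ((4 * (Real.pi / 3) : ℝ) : ℂ)) * Z) +
      Complex.exp (2 * Real.pi * Complex.I / 3) ^ 2 *
        (hexCriticalFugacity * Complex.exp (-Complex.I * (5 / 8 : ℝ) * ((-(Real.pi / 3) : ℝ) : ℂ)) +
          hexCriticalFugacity * Complex.exp (-Complex.I * (5 / 8 : ℝ) * ((4 * -(Real.pi / 3) : ℝ) : ℂ)) * Z) =
      1 + hexCriticalFugacity * (Complex.exp (2 * Real.pi * Complex.I / 3) *
          Complex.exp (-Complex.I * (5 / 8 : ℝ) * ((Real.pi / 3 : ℝ) : ℂ)) +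
        Complex.exp (2 * Real.pi * Complex.I / 3) ^ 2 *
          Complex.exp (-Complex.I * (5 / 8 : ℝ) * ((-(Real.pi / 3) : ℝ) : ℂ))) +
      hexCriticalFugacity * Z * (Complex.exp (2 * Real.pi * Complex.I / 3) *
          Complex.exp (-Complex.I * (5 / 8 : ℝ) * ((4 * (Real.pi / 3) : ℝ) : ℂ)) +
        Complex.exp (2 * Real.pi * Complex.I / 3) ^ 2 *
          Complex.exp (-Complex.I * (5 / 8 : ℝ) * ((4 * -(Real.pi / 3) : ℝ) : ℂ))) := by ring
  rw [expand, e1, e2, e3, e4]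
  push_cast at h1 h2 ⊢
  linear_combination (-(hexCriticalFugacity : ℂ)) * h1 + (-((hexCriticalFugacity : ℂ) * Z)) * h2

/-! ## The reduction -/

/-- **`NoFoldBound → SourceLoopBound`.** If the Beltrami mode of the critical parafermionic
observable is at most `k < 1` times the sum mode at every vertex of every simply connected
domain, then at the SOURCE vertex the returning-loop sum `Z = Σ_{loops of Λ∖v} x_c^ℓ` satisfies
`Z ≤ (kα_T − β_T)/((1+k)√3 x_c) =: c`, and `c < sin(π/8)`; this is `SourceLoopBound` with the
constant `c`. (Exact source law + loop winding + reciprocity; see the module docstring.)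
[folklore] -/
theorem sourceLoopBound_of_noFoldBound
    (h : Summit.CriticalPhenomena.SAWScalingLimit.Theses.SAWDevelopingMap.NoFoldBound) :
    Summit.CriticalPhenomena.SAWScalingLimit.Theses.SAWDevelopingMap.SourceLoopBound := by
  obtain ⟨k, hk1, H⟩ := h
  have hk0 : 1 / 2 < k := noFoldBound_const_gt_half H
  set α : ℝ := 1 + 2 * hexCriticalFugacity * Real.cos (5 * Real.pi / 24) with hα
  set β : ℝ := 1 + 2 * hexCriticalFugacity * Real.cos (11 * Real.pi / 24) with hβ
  have hαpos : 0 < α := nfb_alphaT_pos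
  have hβnn : 0 ≤ β := nfb_betaT_nonneg
  have hx : 0 < hexCriticalFugacity := nfb_xc_pos
  have h3 : 0 < Real.sqrt 3 := Real.sqrt_pos.2 (by norm_num)
  have hαβ : α - β = 2 * Real.sqrt 3 * hexCriticalFugacity * Real.sin (Real.pi / 8) :=
    alphaT_sub_betaT
  have hden : 0 < (1 + k) * (Real.sqrt 3 * hexCriticalFugacity) := by
    have : 0 < 1 + k := by linarith
    positivity
  refine ⟨(k * α - β) / ((1 + k) * (Real.sqrt 3 * hexCriticalFugacity)), ?_, ?_⟩
  · -- `c < sin(π/8)` is `k < 1`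
    rw [div_lt_iff₀ hden]
    have e : Real.sin (Real.pi / 8) * ((1 + k) * (Real.sqrt 3 * hexCriticalFugacity)) =
        (1 + k) * (α - β) / 2 := by
      rw [hαβ]; ring
    rw [e]
    nlinarith [mul_pos (sub_pos.2 hk1) (add_pos_of_pos_of_nonneg hαpos hβnn)]
  · intro Λ hΛ u v w₁ w₂ hu hv huv h₁ h₂ hu₁ hu₂ h₁₂
    have ha : s(u, v) ∈ hexDomainBoundary Λ :=
      ⟨(SimpleGraph.mem_edgeSet hexGraph).2 huv.symm, u, v, rfl, hv, hu⟩
    set Z : ℝ := ∑ γ : HexMidEdgeSAW (Λ.erase v) s(v, w₁) s(v, w₂), hexCriticalFugacity ^ γ.length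
      with hZ
    have hZ0 : 0 ≤ Z := Finset.sum_nonneg fun _ _ => pow_nonneg hx.le _
    -- chirality and the values of the observable at the source vertex
    obtain ⟨ε, hε, T1, -, -, -, -, T2⟩ := stub_localTurns v u w₁ w₂ huv h₁ h₂ hu₁ h₁₂ hu₂
    have hL21 : hexParafermionicObservable (Λ.erase v) s(v, w₂) hexCriticalFugacity (5 / 8)
        s(v, w₁) =
        Complex.exp (-Complex.I * (5 / 8 : ℝ) * ((-5 * -(ε * (Real.pi / 3)) : ℝ) : ℂ)) * (Z : ℂ) := by
      rw [hexParafermionicObservable_def, hZ, ← loopSum_symm h₁ h₂ h₁₂]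
      refine sum_weight_eq_of_winding_eq _ _ _ fun δ => ?_
      rw [stub_loopWinding Λ hΛ u v w₁ w₂ hu hv huv h₁ h₂ hu₁ hu₂ h₁₂ δ, T2]
    have hL12 : hexParafermionicObservable (Λ.erase v) s(v, w₁) hexCriticalFugacity (5 / 8)
        s(v, w₂) =
        Complex.exp (-Complex.I * (5 / 8 : ℝ) * ((-5 * (ε * (Real.pi / 3)) : ℝ) : ℂ)) * (Z : ℂ) := by
      rw [hexParafermionicObservable_def, hZ]
      refine sum_weight_eq_of_winding_eq _ _ _ fun δ => ?_
      rw [stub_loopWinding Λ hΛ u v w₂ w₁ hu hv huv h₂ h₁ hu₂ hu₁ h₁₂.symm δ, T1]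
    have eFu : hexParafermionicObservable Λ s(u, v) hexCriticalFugacity (5 / 8) s(v, u) = 1 := by
      rw [Sym2.eq_swap (a := v)]
      exact hexParafermionicObservable_self ha _ _
    have eF1 : hexParafermionicObservable Λ s(u, v) hexCriticalFugacity (5 / 8) s(v, w₁) =
        hexCriticalFugacity * Complex.exp (-Complex.I * (5 / 8 : ℝ) * ((ε * (Real.pi / 3) : ℝ) : ℂ)) +
        hexCriticalFugacity * Complex.exp (-Complex.I * (5 / 8 : ℝ) *
          ((4 * (ε * (Real.pi / 3)) : ℝ) : ℂ)) * (Z : ℂ) := by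
      rw [SourceLoopBound.sourcePort hu hv huv h₁ h₂ hu₁ hu₂ h₁₂, T1, T2, hL21, xexp_mul_exp_mul,
        show (-(ε * (Real.pi / 3)) + -5 * -(ε * (Real.pi / 3)) : ℝ) = 4 * (ε * (Real.pi / 3)) by
          ring]
    have eF2 : hexParafermionicObservable Λ s(u, v) hexCriticalFugacity (5 / 8) s(v, w₂) =
        hexCriticalFugacity * Complex.exp (-Complex.I * (5 / 8 : ℝ) *
          ((-(ε * (Real.pi / 3)) : ℝ) : ℂ)) +
        hexCriticalFugacity * Complex.exp (-Complex.I * (5 / 8 : ℝ) *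
          ((4 * -(ε * (Real.pi / 3)) : ℝ) : ℂ)) * (Z : ℂ) := by
      rw [SourceLoopBound.sourcePort hu hv huv h₂ h₁ hu₂ hu₁ h₁₂.symm, T1, T2, hL12,
        xexp_mul_exp_mul,
        show (ε * (Real.pi / 3) + -5 * (ε * (Real.pi / 3)) : ℝ) = 4 * -(ε * (Real.pi / 3)) by ring]
    -- the inequality in the two labellings `(u, w₁, w₂)`, `(u, w₂, w₁)`
    have H1 := H Λ hΛ _ ha v hv u w₁ w₂ huv h₁ h₂ hu₁ h₁₂ hu₂
    have H2 := H Λ hΛ _ ha v hv u w₂ w₁ huv h₂ h₁ hu₂ h₁₂.symm hu₁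
    dsimp only at H1 H2
    rw [eFu, eF1, eF2] at H1 H2
    have key : ‖((β + Real.sqrt 3 * hexCriticalFugacity * Z : ℝ) : ℂ)‖ ≤
        k * ‖((α - Real.sqrt 3 * hexCriticalFugacity * Z : ℝ) : ℂ)‖ := by
      rcases hε with rfl | rfl
      · rw [show ((1 : ℝ) * (Real.pi / 3)) = Real.pi / 3 by ring] at H1
        rw [source_belt_mode, source_sum_mode] at H1
        exact H1
      · rw [show ((-1 : ℝ) * (Real.pi / 3)) = -(Real.pi / 3) by ring, neg_neg] at H2
        rw [source_belt_mode, source_sum_mode] at H2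
        exact H2
    rw [Complex.norm_real, Complex.norm_real, Real.norm_eq_abs, Real.norm_eq_abs,
      abs_of_nonneg (by positivity)] at key
    -- `β + √3 x Z ≤ k |α − √3 x Z|` forces `α − √3 x Z ≥ 0` and then `Z ≤ c`
    by_cases hs : 0 ≤ α - Real.sqrt 3 * hexCriticalFugacity * Z
    · rw [abs_of_nonneg hs] at key
      rw [le_div_iff₀ hden]
      nlinarith [key]
    · push Not at hs
      rw [abs_of_neg hs] at key
      nlinarith [key, mul_pos h3 hx, hZ0]

end Summit.CriticalPhenomena.SAWScalingLimit.Theorems.SAWDevelopingMapNoFoldBound
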